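import Summits.Ventures.PercRepro.MSTightProduct

/-!
# The no-extra lemma (F1 of Addendum 37)

Dossier proofs/MINE1-theoremS.md, Addendum 37 (F1). Setting: `L'` a down-set of subsets of a
finite type, `F` a tight nonempty family with `univ ∖ t ∈ L'` for every member (`F ⊆ U`), whose
differences are EXACTLY the members of `L'` lying below a member («no extra»: every such face is a
difference), and a set `u ∉ L'` with the signability condition (Sig) — every `v ∈ L'` inside `u` has
`u ∖ v ∈ L'` or lies below a member — and an A-only set (AO): some `v₀ ∈ L'` inside `u` with
`u ∖ v₀ ∈ L'` lies below no member. This is impossible.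

The proof is Theorem S in its down-closed form (`exists_downSet_upSet_of_tight_of_isDownSet`,
the differences form a down-set because they are the faces): `F = L ⊻ U` with `L` a down-set
outside the addable class `M` and `U` an up-set within `M`, `F \\ F = L ⊻ (M − U)`. The set `u`
meets every member (it is not in `L'`), so `u ∩ M` is not a complement within `M` of a member of
`U`, hence not in `L'`; (Sig) at `u ∖ M` then forces `u ∖ M` to be a face, i.e. a member of `L`;
so `v₀ ∖ M ∈ L`, and `v₀ ⊆ (v₀ ∖ M) ∪ M ∈ F` — against (AO).

Consequences on paper (Addendum 37): a family `T ⊆ U` satisfying (Sig)+(AO) with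
`|L' ∩ ↓T| ≤ |T| + 1` has `T = U ∩ ↓T` and exactly `|T| + 1` faces, and the per-fibre slack of
the removable Case I sits at `u_N` (Addendum 36).
-/

namespace PercRepro.MSTight

open Finset
open scoped FinsetFamily

variable {α : Type*} [DecidableEq α] [Fintype α]

omit [Fintype α] in
/-- A down-set `L'` meets the faces below a family `F` in a down-set. -/
theorem isDownSet_filter_exists_subset {L' F : Finset (Finset α)}
    (hdown : ∀ w ∈ L', ∀ w', w' ⊆ w → w' ∈ L') :
    IsDownSet (L'.filter fun w => ∃ y ∈ F, w ⊆ y) := by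
  intro W hW W' hW'
  rw [mem_filter] at hW ⊢
  obtain ⟨hWL, y, hy, hWy⟩ := hW
  exact ⟨hdown W hWL W' hW', y, hy, hW'.trans hWy⟩

/-- Two unions of a set outside `M` and a set inside `M` agree iff their parts agree. -/
theorem parts_eq_of_union_eq {M x x' z z' : Finset α} (hx : x ⊆ Finset.univ \ M)
    (hx' : x' ⊆ Finset.univ \ M) (hz : z ⊆ M) (hz' : z' ⊆ M) (h : x ∪ z = x' ∪ z') :
    x = x' ∧ z = z' := by
  have hxd : Disjoint x M := disjoint_of_subset_left hx disjoint_sdiff_self_left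
  have hx'd : Disjoint x' M := disjoint_of_subset_left hx' disjoint_sdiff_self_left
  constructor
  · have e1 : (x ∪ z) \ M = x := by
      rw [union_sdiff_distrib, sdiff_eq_self_of_disjoint hxd, sdiff_eq_empty_iff_subset.2 hz,
        union_empty]
    have e2 : (x' ∪ z') \ M = x' := by
      rw [union_sdiff_distrib, sdiff_eq_self_of_disjoint hx'd, sdiff_eq_empty_iff_subset.2 hz',
        union_empty]
    rw [← e1, ← e2, h]
  · have e1 : (x ∪ z) ∩ M = z := by
      rw [union_inter_distrib_right, (disjoint_iff_inter_eq_empty.1 hxd), empty_union,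
        inter_eq_left.2 hz]
    have e2 : (x' ∪ z') ∩ M = z' := by
      rw [union_inter_distrib_right, (disjoint_iff_inter_eq_empty.1 hx'd), empty_union,
        inter_eq_left.2 hz']
    rw [← e1, ← e2, h]

/-- **The no-extra lemma.** A tight nonempty family `F` whose differences are exactly the members
of a down-set `L'` (containing every singleton) below a member, with `univ ∖ t ∈ L'` for every
member, admits no `u ∉ L'` satisfying (Sig) together with an A-only set (AO). -/
theorem not_sig_ao_of_tight_of_diffs_eq_faces {L' F : Finset (Finset α)}
    (hdown : ∀ w ∈ L', ∀ w', w' ⊆ w → w' ∈ L')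
    (hF : Tight F) (hne : F.Nonempty) (hFU : ∀ t ∈ F, Finset.univ \ t ∈ L')
    (hnoextra : F \\ F = L'.filter fun w => ∃ y ∈ F, w ⊆ y)
    (u : Finset α) (hu : u ∉ L')
    (hsig : ∀ v ∈ L', v ⊆ u → u \ v ∈ L' ∨ ∃ y ∈ F, v ⊆ y)
    (hao : ∃ v₀ ∈ L', v₀ ⊆ u ∧ u \ v₀ ∈ L' ∧ ∀ y ∈ F, ¬ v₀ ⊆ y) : False := by
  obtain ⟨v₀, hv₀, hv₀u, -, hv₀F⟩ := hao
  -- the differences form a down-set: Theorem S in its down-closed form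
  have hD : IsDownSet (F \\ F) := by
    rw [hnoextra]; exact isDownSet_filter_exists_subset hdown
  obtain ⟨M, -, L, U, hL, hLN, hU, hUM, hFLU, hDLU⟩ :=
    exists_downSet_upSet_of_tight_of_isDownSet hF hD (fun A _ => subset_univ A)
  -- `L` and `U` are nonempty, so `∅ ∈ L` and `M ∈ U`
  have hLne : L.Nonempty := by
    obtain ⟨t, ht⟩ := hne
    rw [hFLU] at ht
    obtain ⟨x, hx, -, -, -⟩ := mem_sups.1 ht
    exact ⟨x, hx⟩
  have hUne : U.Nonempty := by
    obtain ⟨t, ht⟩ := hne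
    rw [hFLU] at ht
    obtain ⟨-, -, z, hz, -⟩ := mem_sups.1 ht
    exact ⟨z, hz⟩
  have hemptyL : (∅ : Finset α) ∈ L := by
    obtain ⟨x, hx⟩ := hLne
    exact hL x hx ∅ (empty_subset _)
  have hMU : M ∈ U := by
    obtain ⟨z, hz⟩ := hUne
    exact hU z hz M (subset_refl _) (hUM z hz)
  have hMF : M ∈ F := by
    rw [hFLU]; exact mem_sups.2 ⟨∅, hemptyL, M, hMU, by simp⟩
  -- `u` meets every member, in particular every member of `U`
  have hmeet : ∀ t ∈ F, ¬ Disjoint u t := by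
    intro t ht hdis
    apply hu
    exact hdown _ (hFU t ht) u (subset_sdiff.2 ⟨subset_univ _, hdis⟩)
  have hUmem : ∀ z ∈ U, z ∈ F := by
    intro z hz
    rw [hFLU]; exact mem_sups.2 ⟨∅, hemptyL, z, hz, by simp⟩
  -- `u ∩ M` is not the complement within `M` of a member of `U`, hence not in `L'`
  have huM : u ∩ M ∉ complWithin M U := by
    intro h
    obtain ⟨z, hz, hzeq⟩ := mem_complWithin.1 h
    apply hmeet z (hUmem z hz)
    rw [disjoint_iff_inter_eq_empty]
    have hzM : z ⊆ M := hUM z hz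
    have : u ∩ z = (u ∩ M) ∩ z := by rw [inter_assoc, inter_eq_right.2 hzM]
    rw [this, ← hzeq, inter_comm]
    exact inter_sdiff_self z M
  have huML : u ∩ M ∉ L' := by
    intro h
    have hface : u ∩ M ∈ F \\ F := by
      rw [hnoextra, mem_filter]
      exact ⟨h, M, hMF, inter_subset_right⟩
    rw [hDLU] at hface
    obtain ⟨x, hx, z', hz', hxz⟩ := mem_sups.1 hface
    have hz'M : z' ⊆ M := by
      obtain ⟨z, -, rfl⟩ := mem_complWithin.1 hz'
      exact sdiff_subset
    have hxz' : x ∪ z' = ∅ ∪ (u ∩ M) := by simpa using hxz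
    obtain ⟨-, hz'eq⟩ := parts_eq_of_union_eq (hLN x hx) (empty_subset _) hz'M inter_subset_right hxz'
    rw [← hz'eq] at huM
    exact huM hz'
  -- (Sig) at `u ∖ M` makes it a face, hence a member of `L`
  have huNL' : u \ M ∈ L' :=
    hdown _ (hFU M hMF) _ (sdiff_subset_sdiff (subset_univ _) (subset_refl _))
  have huNL : u \ M ∈ L := by
    rcases hsig _ huNL' sdiff_subset with h | ⟨y, hy, hsub⟩
    · exact absurd (by simpa [sdiff_sdiff_right_self] using h) huML
    · have hface : u \ M ∈ F \\ F := by
        rw [hnoextra, mem_filter]; exact ⟨huNL', y, hy, hsub⟩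
      rw [hDLU] at hface
      obtain ⟨x, hx, z', hz', hxz⟩ := mem_sups.1 hface
      have hz'M : z' ⊆ M := by
        obtain ⟨z, -, rfl⟩ := mem_complWithin.1 hz'
        exact sdiff_subset
      have hxz' : x ∪ z' = (u \ M) ∪ ∅ := by simpa using hxz
      obtain ⟨hxeq, -⟩ := parts_eq_of_union_eq (hLN x hx)
        (sdiff_subset_sdiff (subset_univ _) (subset_refl _)) hz'M (empty_subset _) hxz'
      rw [← hxeq]; exact hx
  -- `v₀ ∖ M ∈ L`, so `v₀ ⊆ (v₀ ∖ M) ∪ M ∈ F` — against (AO)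
  have hv₀L : v₀ \ M ∈ L := hL _ huNL _ (sdiff_subset_sdiff hv₀u (subset_refl _))
  have hmem : (v₀ \ M) ∪ M ∈ F := by
    rw [hFLU]; exact mem_sups.2 ⟨_, hv₀L, M, hMU, rfl⟩
  exact hv₀F _ hmem (by intro a ha; by_cases haM : a ∈ M <;> simp [ha, haM])

end PercRepro.MSTight

/-!
# `T = U ∩ ↓T` and the slack is exactly one (F2 of Addendum 37)

With the no-extra lemma `not_sig_ao_of_tight_of_diffs_eq_faces` (MSTightNoExtra.lean) and the
Marica–Schönheim inequality `Finset.card_le_card_diffs`: a nonempty family `T` with `univ ∖ y ∈ L'`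
for every member (`T ⊆ U`), at most `|T| + 1` faces (`(L'.filter fun w => ∃ y ∈ T, w ⊆ y)` = the members of the down-set
`L'` below a member, MSTightRStarTop.lean), and a set `u ∉ L'` with (Sig) and (AO), has EXACTLY
`|T| + 1` faces, and every `z` with `univ ∖ z ∈ L'` lying below a member is itself a member — `T`
is the family of members of `U` inside the complex `↓T`. Both are the no-extra lemma applied to
`T` itself, resp. to `T ∪ {z}`, after the count forces tightness and «differences = faces».
-/

namespace PercRepro.MSTight

open Finset
open scoped FinsetFamily

variable {α : Type*} [DecidableEq α] [Fintype α]

/-- The differences of a family whose complements lie in the down-set `L'` are faces. -/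
theorem diffs_subset_faces {L' T : Finset (Finset α)}
    (hdown : ∀ w ∈ L', ∀ w', w' ⊆ w → w' ∈ L') (hTU : ∀ y ∈ T, Finset.univ \ y ∈ L') :
    T \\ T ⊆ (L'.filter fun w => ∃ y ∈ T, w ⊆ y) := by
  intro d hd
  obtain ⟨y, hy, y', hy', rfl⟩ := mem_diffs.1 hd
  exact mem_filter.2 ⟨hdown _ (hTU y' hy') _ (sdiff_subset_sdiff (subset_univ y) (subset_refl y')),
    y, hy, sdiff_subset⟩

/-- Under the hypotheses of (R*-M) (with `|faces| ≤ |T| + 1`), a family with `|faces| ≤ |T|` is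
impossible: it would be tight with «differences = faces», against the no-extra lemma. -/
theorem not_card_faces_le {L' T : Finset (Finset α)}
    (hdown : ∀ w ∈ L', ∀ w', w' ⊆ w → w' ∈ L')
    (hne : T.Nonempty) (hTU : ∀ y ∈ T, Finset.univ \ y ∈ L')
    (u : Finset α) (hu : u ∉ L')
    (hsig : ∀ v ∈ L', v ⊆ u → u \ v ∈ L' ∨ ∃ y ∈ T, v ⊆ y)
    (hao : ∃ v₀ ∈ L', v₀ ⊆ u ∧ u \ v₀ ∈ L' ∧ ∀ y ∈ T, ¬ v₀ ⊆ y)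
    (hle : ((L'.filter fun w => ∃ y ∈ T, w ⊆ y)).card ≤ T.card) : False := by
  have h1 : T.card ≤ (T \\ T).card := card_le_card_diffs T
  have h2 : (T \\ T).card ≤ ((L'.filter fun w => ∃ y ∈ T, w ⊆ y)).card := card_le_card (diffs_subset_faces hdown hTU)
  have hF : Tight T := by
    unfold Tight; omega
  have hnoextra : T \\ T = (L'.filter fun w => ∃ y ∈ T, w ⊆ y) :=
    eq_of_subset_of_card_le (diffs_subset_faces hdown hTU) (by omega)
  exact not_sig_ao_of_tight_of_diffs_eq_faces hdown hF hne hTU hnoextra u hu hsig hao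

/-- **The slack is exactly one.** -/
theorem card_faces_eq_succ {L' T : Finset (Finset α)}
    (hdown : ∀ w ∈ L', ∀ w', w' ⊆ w → w' ∈ L')
    (hne : T.Nonempty) (hTU : ∀ y ∈ T, Finset.univ \ y ∈ L')
    (hcnt : ((L'.filter fun w => ∃ y ∈ T, w ⊆ y)).card ≤ T.card + 1)
    (u : Finset α) (hu : u ∉ L')
    (hsig : ∀ v ∈ L', v ⊆ u → u \ v ∈ L' ∨ ∃ y ∈ T, v ⊆ y)
    (hao : ∃ v₀ ∈ L', v₀ ⊆ u ∧ u \ v₀ ∈ L' ∧ ∀ y ∈ T, ¬ v₀ ⊆ y) :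
    ((L'.filter fun w => ∃ y ∈ T, w ⊆ y)).card = T.card + 1 := by
  by_contra h
  exact not_card_faces_le hdown hne hTU u hu hsig hao (by omega)

omit [Fintype α] in
/-- Inserting a set below a member does not change the faces. -/
theorem faces_insert_of_subset_mem {L' T : Finset (Finset α)} {z : Finset α}
    (hz : ∃ y ∈ T, z ⊆ y) : (L'.filter fun w => ∃ y ∈ insert z T, w ⊆ y) = (L'.filter fun w => ∃ y ∈ T, w ⊆ y) := by
  ext w
  rw [mem_filter, mem_filter]
  constructor
  · rintro ⟨hw, y, hy, hwy⟩
    rw [mem_insert] at hy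
    rcases hy with rfl | hy
    · obtain ⟨y', hy', hzy'⟩ := hz
      exact ⟨hw, y', hy', hwy.trans hzy'⟩
    · exact ⟨hw, y, hy, hwy⟩
  · rintro ⟨hw, y, hy, hwy⟩
    exact ⟨hw, y, mem_insert_of_mem hy, hwy⟩

/-- **`T = U ∩ ↓T`.** Under the hypotheses of (R*-M), every set `z` with `univ ∖ z ∈ L'` lying
below a member of `T` is a member of `T`. -/
theorem mem_of_compl_mem_of_exists_subset {L' T : Finset (Finset α)}
    (hdown : ∀ w ∈ L', ∀ w', w' ⊆ w → w' ∈ L')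
    (hTU : ∀ y ∈ T, Finset.univ \ y ∈ L')
    (hcnt : ((L'.filter fun w => ∃ y ∈ T, w ⊆ y)).card ≤ T.card + 1)
    (u : Finset α) (hu : u ∉ L')
    (hsig : ∀ v ∈ L', v ⊆ u → u \ v ∈ L' ∨ ∃ y ∈ T, v ⊆ y)
    (hao : ∃ v₀ ∈ L', v₀ ⊆ u ∧ u \ v₀ ∈ L' ∧ ∀ y ∈ T, ¬ v₀ ⊆ y)
    {z : Finset α} (hz : Finset.univ \ z ∈ L') (hzT : ∃ y ∈ T, z ⊆ y) : z ∈ T := by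
  by_contra hzn
  have hfaces : (L'.filter fun w => ∃ y ∈ insert z T, w ⊆ y) = (L'.filter fun w => ∃ y ∈ T, w ⊆ y) := faces_insert_of_subset_mem hzT
  have hne' : (insert z T).Nonempty := insert_nonempty z T
  have hTU' : ∀ y ∈ insert z T, Finset.univ \ y ∈ L' := by
    intro y hy
    rw [mem_insert] at hy
    rcases hy with rfl | hy
    · exact hz
    · exact hTU y hy
  have hsig' : ∀ v ∈ L', v ⊆ u → u \ v ∈ L' ∨ ∃ y ∈ insert z T, v ⊆ y := by
    intro v hv hvu
    rcases hsig v hv hvu with h | ⟨y, hy, hvy⟩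
    · exact Or.inl h
    · exact Or.inr ⟨y, mem_insert_of_mem hy, hvy⟩
  have hao' : ∃ v₀ ∈ L', v₀ ⊆ u ∧ u \ v₀ ∈ L' ∧ ∀ y ∈ insert z T, ¬ v₀ ⊆ y := by
    obtain ⟨v₀, hv₀, hv₀u, hv₀c, hv₀T⟩ := hao
    refine ⟨v₀, hv₀, hv₀u, hv₀c, ?_⟩
    intro y hy hsub
    rw [mem_insert] at hy
    rcases hy with rfl | hy
    · obtain ⟨y', hy', hzy'⟩ := hzT
      exact hv₀T y' hy' (hsub.trans hzy')
    · exact hv₀T y hy hsub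
  have hcard : (insert z T).card = T.card + 1 := card_insert_of_notMem hzn
  apply not_card_faces_le hdown hne' hTU' u hu hsig' hao'
  rw [hfaces, hcard]
  exact hcnt

end PercRepro.MSTight
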